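import Literature.Analysis.FluidPDE.LeiZhang2017LogHardy
import Literature.Analysis.FluidPDE.Wei2016Lemma23
import Literature.Analysis.FluidPDE.AxisymHouLiVariables
import HarnessLib

/-!
# Lei–Zhang 2017, proof of Cor. 1.3: the Form Boundedness Condition from the critical modulus
# `|Γ| ≤ C₁/|ln r|²` (the inequalities (2.1)–(2.2) = (FBC-1)–(FBC-2), on rays and on `ℝ³`)

Analysis/FluidPDE proof file (theorems only; no definitions, no named facts) on the discharge path
of the named fact `Literature.Analysis.FluidPDE.LeiZhang2017_logModulus_regularity`
(Lei–Zhang 2017, arXiv:1505.02628, Cor. 1.3). The printed proof (end of §2, arXiv p. 7):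

> "It suffices to check the validity of FBC in (1.7)–(1.8) under the assumptions in Corollary.
> … using the maximum principle, we have `‖Γ(t,·)‖_∞ ≤ ‖Γ₀‖_∞`. Take a smooth cut-off function
> `φ ≡ 1` if `0 ≤ r ≤ 1`, `φ ≡ 0` if `r ≥ 2`. For all `δ < δ₀/2`, using (1.9), one has
> `∫ (|v^θ|/r)|φ(r/δ)f|² ≤ ∫ C₁/(r²|ln r|²) |φ(r/δ)f|²` … [log-Hardy by parts] …
> Consequently `∫ (|v^θ|/r)|f|² ≤ 4C₁∫|∂ᵣf|² + Cδ⁻²∫_{r ≥ δ}|f|²` (2.1), and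
> `∫ |v^θ|²|f|² ≤ Cδ⁻²∫_{r≥δ}|f|² + 8C₁²|ln δ|⁻²∫|∂ᵣf|²` (2.2). Hence one may choose `δ` small
> enough so that `16C₁²|ln δ|⁻² ≤ δ_*` and choose `C_* = 4C₁`."

This file proves (2.1)–(2.2) with explicit constants (the printed integration by parts drops a
factor `2`, whence the log-Hardy constant `4` of `logHardy_of_eq_zero` and the constants `16C₁`,
`16C₁²/ln²(2δ)` below instead of `4C₁`, `8C₁²/ln²δ` — immaterial for Cor. 1.3):

* on rays (`w = u₁(ρ,0,z) = u^θ`, so `ρ|w| = |Γ|`; `f` a `C¹` profile with values in a real inner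
  product space; `φ = Wei2016.radialCutoff (2δ)`, `= 1` on `[0, δ]`, `= 0` on `[2δ, ∞)`):
  `ray_near_le` — `∫₀ᴿ |w| ‖φf‖² ≤ 8C₁ ∫₀ᴿ ρ‖f'‖² + 8C₁D²δ⁻² ∫_δ^R ρ‖f‖²` (log-Hardy on `(0, 2δ]`);
  `ray_fbc_one` — **(2.1) on a ray**: `∫₀ᴿ |w| ‖f‖² ≤ 16C₁ ∫₀ᴿ ρ‖f'‖² + (16C₁D² + 2M)δ⁻² ∫_δ^R ρ‖f‖²`;
  `ray_fbc_two` — **(2.2) on a ray**: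
  `∫₀ᴿ ρ w² ‖f‖² ≤ (16C₁²/ln²(2δ)) ∫₀ᴿ ρ‖f'‖² + (16C₁²D²/ln²(2δ) + 2M²)δ⁻² ∫_δ^R ρ‖f‖²`,
  under `ρ|w(ρ)| ≤ C₁/ln²ρ` on `(0, 2δ]` and `ρ|w| ≤ M`;
* on `ℝ³` (`dx = r dr dθ dz`, `Wei2016.integral_le_of_forall_ray_le`), for an axisymmetric
  `u ∈ C²` with `|Γ| ≤ C₁/ln²r` on `r ≤ 2δ`, `|Γ| ≤ M`, and a `C¹` field `F` with `‖F‖²`,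
  `‖DF[e_r]‖²` axisymmetric:
  `integral_abs_angVelQuot_mul_norm_sq_le` — **(FBC-1)**
  `∫ |u^θ/r| ‖F‖² ≤ 16C₁ ∫ ‖DF[e_r]‖² + (16C₁D² + 2M)δ⁻² ∫_{r > δ} ‖F‖²`;
  `integral_swirl_sq_mul_norm_sq_le` — **(FBC-2)**
  `∫ (u^θ)² ‖F‖² ≤ (16C₁²/ln²(2δ)) ∫ ‖DF[e_r]‖² + (16C₁²D²/ln²(2δ) + 2M²)δ⁻² ∫_{r > δ} ‖F‖²`
  (`(u^θ)² = (r · angVelQuot u)²`), `D = Wei2016.stDerivBound`.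

## Mathlib / tree search

Tree: `logHardy_of_eq_zero`, `logHardy` (`LeiZhang2017LogHardy`), `Wei2016.radialCutoff` & API,
`Wei2016.stDerivBound` (`Wei2016HardyCutoff`), `Wei2016.integral_le_of_forall_ray_le`
(`Wei2016RayTransfer`), `Wei2016.swirl_meridianPoint`, `Wei2016.apply_zero_one_eq_zero_of_axis`
(`Wei2016Lemma23`), `eR_meridianPoint`, `hasDerivAt_meridianPoint_fst`,
`cylRadius_meridianPoint_eq_abs` (`CylindricalIntegration`), `IsAxisymmetric.cylRadius_sq_mul_angVelQuot`
(`AxisymHouLiVariables`). Wei's (2.3)–(2.4) (`Wei2016Lemma23`) are the analogous inequalities under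
Wei's hypothesis on `∫₀ʳ|u_θ|`; here the hypothesis is the pointwise modulus of Lei–Zhang.

## References

* Z. Lei, Q. S. Zhang, Pacific J. Math. 289 (2017) 169–187, arXiv:1505.02628, proof of Cor. 1.3
  (end of §2, arXiv p. 7), (2.1)–(2.2); Thm. 1.2 (FBC (1.7)–(1.8)). [`LeiZhang2017`]
-/

noncomputable section

open MeasureTheory Set Function Filter Topology intervalIntegral
open scoped RealInnerProductSpace ENNReal

namespace Literature.Analysis.FluidPDE

namespace LeiZhang2017

variable {E : Type*} [NormedAddCommGroup E]

/-! ### The cut-off `φ = Wei2016.radialCutoff (2δ)` -/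

/-- The radial cut-off is smooth. [folklore] -/
theorem contDiff_radialCutoff (a : ℝ) {n : ℕ∞} : ContDiff ℝ n (Wei2016.radialCutoff a) := by
  have h : Wei2016.radialCutoff a = fun r => Real.smoothTransition (2 - 2 * (r / a)) := rfl
  rw [h]
  exact Real.smoothTransition.contDiff.comp
    (contDiff_const.sub (contDiff_const.mul (contDiff_id.div_const a)))

/-- The derivative of the cut-off is `Wei2016.radialCutoffDeriv`. [folklore] -/
theorem deriv_radialCutoff (a r : ℝ) : deriv (Wei2016.radialCutoff a) r = Wei2016.radialCutoffDeriv a r :=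
  (Wei2016.hasDerivAt_radialCutoff a r).deriv

/-! ### Elementary real-variable facts -/

/-- `(x + y)² ≤ 2x² + 2y²` for norms: `‖p + q‖² ≤ 2‖p‖² + 2‖q‖²`. [folklore] -/
theorem norm_add_sq_le_two_mul (p q : E) : ‖p + q‖ ^ 2 ≤ 2 * ‖p‖ ^ 2 + 2 * ‖q‖ ^ 2 := by
  nlinarith [norm_add_le p q, sq_nonneg (‖p‖ - ‖q‖), norm_nonneg (p + q), norm_nonneg p,
    norm_nonneg q]

variable [InnerProductSpace ℝ E]

/-- For `0 < ρ ≤ a < 1`: `ln²a ≤ ln²ρ`. [folklore] -/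
theorem log_sq_le_log_sq {ρ a : ℝ} (hρ : 0 < ρ) (hρa : ρ ≤ a) (ha : a < 1) :
    Real.log a ^ 2 ≤ Real.log ρ ^ 2 := by
  have h1 : Real.log ρ ≤ Real.log a := Real.log_le_log hρ hρa
  have h2 : Real.log a < 0 := Real.log_neg (hρ.trans_le hρa) ha
  nlinarith

/-! ### The ray inequalities -/

section Ray

variable {w : ℝ → ℝ} {f : ℝ → E} {C₁ M δ D R : ℝ}

/-- **The near-axis term** (log-Hardy with the cut-off): with `φ = Wei2016.radialCutoff (2δ)`,
`∫₀ᴿ |w| ‖φ f‖² ≤ 8C₁ ∫₀ᴿ ρ ‖f'‖² + 8C₁D²δ⁻² ∫_δ^R ρ ‖f‖²` whenever `ρ|w(ρ)| ≤ C₁/ln²ρ` on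
`(0, 2δ]`, `2δ < 1`, `|smoothTransition'| ≤ D`, `R ≥ 2δ`.
[cite: LeiZhang2017, proof of Cor. 1.3 (arXiv p. 7, the display ending in (2.1))] -/
theorem ray_near_le (hδ : 0 < δ) (h2δ : 2 * δ < 1) (hw : Continuous w) (hf : ContDiff ℝ 1 f)
    (hC₁ : 0 ≤ C₁) (hD : ∀ t, |deriv Real.smoothTransition t| ≤ D)
    (hmod : ∀ ρ, 0 < ρ → ρ ≤ 2 * δ → ρ * |w ρ| ≤ C₁ / Real.log ρ ^ 2) (hR : 2 * δ ≤ R) :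
    ∫ ρ in (0 : ℝ)..R, |w ρ| * ‖Wei2016.radialCutoff (2 * δ) ρ • f ρ‖ ^ 2 ≤
      8 * C₁ * (∫ ρ in (0 : ℝ)..R, ρ * ‖deriv f ρ‖ ^ 2) +
        8 * C₁ * D ^ 2 / δ ^ 2 * ∫ ρ in δ..R, ρ * ‖f ρ‖ ^ 2 := by
  set a := 2 * δ with ha_def
  have ha0 : 0 < a := by positivity
  have hδa : δ ≤ a := by linarith
  have haR : a ≤ R := hR
  set φ := Wei2016.radialCutoff a with hφ_def
  set φ' := Wei2016.radialCutoffDeriv a with hφ'_def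
  have hφc : ContDiff ℝ 1 φ := contDiff_radialCutoff a
  have hφcont : Continuous φ := hφc.continuous
  have hφ'cont : Continuous φ' := Wei2016.continuous_radialCutoffDeriv a
  have hfd : Differentiable ℝ f := hf.differentiable one_ne_zero
  have hfc : Continuous f := hf.continuous
  have hf'c : Continuous (deriv f) := hf.continuous_deriv_one
  have hφ1 : ∀ ρ, ρ ≤ δ → φ ρ = 1 := fun ρ hρ =>
    Wei2016.radialCutoff_eq_one ha0 (by rw [ha_def]; linarith)
  have hφ0 : ∀ ρ, a ≤ ρ → φ ρ = 0 := fun ρ hρ => Wei2016.radialCutoff_eq_zero ha0 hρ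
  have hφ'0 : ∀ ρ, ρ ≤ δ → φ' ρ = 0 := fun ρ hρ =>
    Wei2016.radialCutoffDeriv_eq_zero_of_le ha0 (by rw [ha_def]; linarith)
  have hD0 : 0 ≤ D := (abs_nonneg _).trans (hD 0)
  have hφ'le : ∀ ρ, |φ' ρ| ≤ D / δ := fun ρ => by
    have h := Wei2016.abs_radialCutoffDeriv_le ha0 hD ρ
    rw [ha_def] at h
    calc |φ' ρ| ≤ 2 * D / (2 * δ) := h
      _ = D / δ := by field_simp
  have hφle1 : ∀ ρ, |φ ρ| ≤ 1 := fun ρ => by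
    rw [abs_of_nonneg (Wei2016.radialCutoff_nonneg a ρ)]; exact Wei2016.radialCutoff_le_one a ρ
  -- the truncated profile `h = φ f` and its derivative
  set h : ℝ → E := fun ρ => φ ρ • f ρ with hh_def
  have hh : ContDiff ℝ 1 h := hφc.smul hf
  have hhc : Continuous h := hh.continuous
  have hderiv : ∀ ρ, deriv h ρ = φ ρ • deriv f ρ + φ' ρ • f ρ := fun ρ => by
    have h1 := (Wei2016.hasDerivAt_radialCutoff a ρ).smul (hfd ρ).hasDerivAt
    exact h1.deriv
  have hha : h a = 0 := by simp only [hh_def, hφ0 a le_rfl, zero_smul]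
  -- Step 1: log-Hardy on `(0, a]`
  have hLH := logHardy_of_eq_zero hh ha0 (by linarith) hha
  have hLHi := (logHardy hh ha0 (by linarith)).1
  -- Step 2: the integrand vanishes on `[a, R]`
  have hint_w : ∀ b c, IntervalIntegrable (fun ρ => |w ρ| * ‖h ρ‖ ^ 2) volume b c := fun b c =>
    ((continuous_abs.comp hw).mul (hhc.norm.pow 2)).intervalIntegrable b c
  have hsplit : ∫ ρ in (0 : ℝ)..R, |w ρ| * ‖h ρ‖ ^ 2 = ∫ ρ in (0 : ℝ)..a, |w ρ| * ‖h ρ‖ ^ 2 := by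
    rw [← integral_add_adjacent_intervals (hint_w 0 a) (hint_w a R)]
    have hz : ∫ ρ in a..R, |w ρ| * ‖h ρ‖ ^ 2 = 0 := by
      have heq : EqOn (fun ρ => |w ρ| * ‖h ρ‖ ^ 2) (fun _ => (0 : ℝ)) (uIcc a R) := fun ρ hρ => by
        rw [uIcc_of_le haR] at hρ
        simp [hh_def, hφ0 ρ hρ.1]
      rw [intervalIntegral.integral_congr heq]
      simp
    rw [hz, add_zero]
  -- Step 3: `|w| ‖h‖² ≤ C₁ ‖h‖²/(ρ ln²ρ)` on `(0, a)`
  have hstep3 : ∫ ρ in (0 : ℝ)..a, |w ρ| * ‖h ρ‖ ^ 2 ≤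
      C₁ * ∫ ρ in (0 : ℝ)..a, ‖h ρ‖ ^ 2 / (ρ * Real.log ρ ^ 2) := by
    rw [← intervalIntegral.integral_const_mul]
    refine integral_mono_on_of_le_Ioo ha0.le (hint_w 0 a) (hLHi.const_mul C₁) fun ρ hρ => ?_
    have hm := hmod ρ hρ.1 hρ.2.le
    have hlog : 0 < Real.log ρ ^ 2 :=
      sq_pos_of_neg (Real.log_neg hρ.1 (by linarith [hρ.2]))
    have hwle : |w ρ| ≤ C₁ / (ρ * Real.log ρ ^ 2) := by
      rw [le_div_iff₀ (mul_pos hρ.1 hlog)]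
      calc |w ρ| * (ρ * Real.log ρ ^ 2) = ρ * |w ρ| * Real.log ρ ^ 2 := by ring
        _ ≤ C₁ / Real.log ρ ^ 2 * Real.log ρ ^ 2 := by gcongr
        _ = C₁ := div_mul_cancel₀ C₁ hlog.ne'
    calc |w ρ| * ‖h ρ‖ ^ 2 ≤ C₁ / (ρ * Real.log ρ ^ 2) * ‖h ρ‖ ^ 2 := by gcongr
      _ = C₁ * (‖h ρ‖ ^ 2 / (ρ * Real.log ρ ^ 2)) := by ring
  -- Step 4: `∫₀ᵃ ρ ‖h'‖² ≤ 2 ∫₀ᵃ ρ ‖f'‖² + 2 (D/δ)² ∫_δ^a ρ ‖f‖²`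
  have hint_f' : ∀ b c, IntervalIntegrable (fun ρ => ρ * ‖deriv f ρ‖ ^ 2) volume b c := fun b c =>
    (continuous_id.mul (hf'c.norm.pow 2)).intervalIntegrable b c
  have hint_f : ∀ b c, IntervalIntegrable (fun ρ => ρ * ‖f ρ‖ ^ 2) volume b c := fun b c =>
    (continuous_id.mul (hfc.norm.pow 2)).intervalIntegrable b c
  have hint_φ'f : ∀ b c, IntervalIntegrable (fun ρ => ρ * (φ' ρ ^ 2 * ‖f ρ‖ ^ 2)) volume b c :=
    fun b c => (continuous_id.mul ((hφ'cont.pow 2).mul (hfc.norm.pow 2))).intervalIntegrable b c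
  have hderiv_c : Continuous fun ρ => ‖deriv h ρ‖ ^ 2 * ρ := by
    have : Continuous (deriv h) := hh.continuous_deriv_one
    exact (this.norm.pow 2).mul continuous_id
  have hstep4a : ∫ ρ in (0 : ℝ)..a, ‖deriv h ρ‖ ^ 2 * ρ ≤
      2 * (∫ ρ in (0 : ℝ)..a, ρ * ‖deriv f ρ‖ ^ 2) +
        2 * ∫ ρ in (0 : ℝ)..a, ρ * (φ' ρ ^ 2 * ‖f ρ‖ ^ 2) := by
    rw [← intervalIntegral.integral_const_mul, ← intervalIntegral.integral_const_mul,
      ← intervalIntegral.integral_add ((hint_f' 0 a).const_mul 2) ((hint_φ'f 0 a).const_mul 2)]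
    refine integral_mono_on ha0.le (hderiv_c.intervalIntegrable 0 a)
      (((hint_f' 0 a).const_mul 2).add ((hint_φ'f 0 a).const_mul 2)) fun ρ hρ => ?_
    rw [hderiv ρ]
    have h1 := norm_add_sq_le_two_mul (φ ρ • deriv f ρ) (φ' ρ • f ρ)
    rw [norm_smul, norm_smul, mul_pow, mul_pow, Real.norm_eq_abs, Real.norm_eq_abs, sq_abs,
      sq_abs] at h1
    have h2 : φ ρ ^ 2 ≤ 1 := by
      have := hφle1 ρ
      nlinarith [abs_nonneg (φ ρ), sq_abs (φ ρ)]
    have hρ0 : 0 ≤ ρ := hρ.1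
    nlinarith [mul_nonneg hρ0 (sq_nonneg ‖deriv f ρ‖),
      mul_le_mul_of_nonneg_right h2 (sq_nonneg ‖deriv f ρ‖)]
  have hstep4b : ∫ ρ in (0 : ℝ)..a, ρ * (φ' ρ ^ 2 * ‖f ρ‖ ^ 2) ≤
      (D / δ) ^ 2 * ∫ ρ in δ..a, ρ * ‖f ρ‖ ^ 2 := by
    -- vanishes on `[0, δ]`
    rw [← integral_add_adjacent_intervals (hint_φ'f 0 δ) (hint_φ'f δ a)]
    have hz : ∫ ρ in (0 : ℝ)..δ, ρ * (φ' ρ ^ 2 * ‖f ρ‖ ^ 2) = 0 := by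
      have heq : EqOn (fun ρ => ρ * (φ' ρ ^ 2 * ‖f ρ‖ ^ 2)) (fun _ => (0 : ℝ)) (uIcc 0 δ) :=
        fun ρ hρ => by
          rw [uIcc_of_le hδ.le] at hρ
          simp [hφ'0 ρ hρ.2]
      rw [intervalIntegral.integral_congr heq]
      simp
    rw [hz, zero_add, ← intervalIntegral.integral_const_mul]
    refine integral_mono_on hδa (hint_φ'f δ a) ((hint_f δ a).const_mul _) fun ρ hρ => ?_
    have hρ0 : 0 ≤ ρ := hδ.le.trans hρ.1
    have h1 : φ' ρ ^ 2 ≤ (D / δ) ^ 2 := by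
      have := hφ'le ρ
      rw [← sq_abs]
      exact pow_le_pow_left₀ (abs_nonneg _) this 2
    calc ρ * (φ' ρ ^ 2 * ‖f ρ‖ ^ 2) ≤ ρ * ((D / δ) ^ 2 * ‖f ρ‖ ^ 2) := by gcongr
      _ = (D / δ) ^ 2 * (ρ * ‖f ρ‖ ^ 2) := by ring
  -- Step 5: enlarge the intervals
  have hmono1 : ∫ ρ in (0 : ℝ)..a, ρ * ‖deriv f ρ‖ ^ 2 ≤ ∫ ρ in (0 : ℝ)..R, ρ * ‖deriv f ρ‖ ^ 2 :=
    integral_mono_interval le_rfl ha0.le haR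
      ((ae_restrict_mem measurableSet_Ioc).mono fun ρ hρ => by
        exact mul_nonneg hρ.1.le (sq_nonneg _)) (hint_f' 0 R)
  have hmono2 : ∫ ρ in δ..a, ρ * ‖f ρ‖ ^ 2 ≤ ∫ ρ in δ..R, ρ * ‖f ρ‖ ^ 2 :=
    integral_mono_interval le_rfl hδa haR
      ((ae_restrict_mem measurableSet_Ioc).mono fun ρ hρ => by
        exact mul_nonneg (hδ.le.trans hρ.1.le) (sq_nonneg _)) (hint_f δ R)
  have hI1 : 0 ≤ ∫ ρ in (0 : ℝ)..R, ρ * ‖deriv f ρ‖ ^ 2 :=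
    intervalIntegral.integral_nonneg (by linarith) fun ρ hρ => mul_nonneg hρ.1 (sq_nonneg _)
  have hI2 : 0 ≤ ∫ ρ in δ..R, ρ * ‖f ρ‖ ^ 2 :=
    intervalIntegral.integral_nonneg (by linarith) fun ρ hρ => mul_nonneg (hδ.le.trans hρ.1) (sq_nonneg _)
  -- assemble
  rw [hsplit]
  calc ∫ ρ in (0 : ℝ)..a, |w ρ| * ‖h ρ‖ ^ 2
      ≤ C₁ * ∫ ρ in (0 : ℝ)..a, ‖h ρ‖ ^ 2 / (ρ * Real.log ρ ^ 2) := hstep3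
    _ ≤ C₁ * (4 * ∫ ρ in (0 : ℝ)..a, ‖deriv h ρ‖ ^ 2 * ρ) := by gcongr
    _ ≤ C₁ * (4 * (2 * (∫ ρ in (0 : ℝ)..R, ρ * ‖deriv f ρ‖ ^ 2) +
          2 * ((D / δ) ^ 2 * ∫ ρ in δ..R, ρ * ‖f ρ‖ ^ 2))) := by
        gcongr
        calc ∫ ρ in (0 : ℝ)..a, ‖deriv h ρ‖ ^ 2 * ρ
            ≤ 2 * (∫ ρ in (0 : ℝ)..a, ρ * ‖deriv f ρ‖ ^ 2) +
                2 * ∫ ρ in (0 : ℝ)..a, ρ * (φ' ρ ^ 2 * ‖f ρ‖ ^ 2) := hstep4a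
          _ ≤ 2 * (∫ ρ in (0 : ℝ)..R, ρ * ‖deriv f ρ‖ ^ 2) +
                2 * ((D / δ) ^ 2 * ∫ ρ in δ..R, ρ * ‖f ρ‖ ^ 2) := by
              gcongr
              exact hstep4b.trans (mul_le_mul_of_nonneg_left hmono2 (sq_nonneg _))
    _ = 8 * C₁ * (∫ ρ in (0 : ℝ)..R, ρ * ‖deriv f ρ‖ ^ 2) +
          8 * C₁ * D ^ 2 / δ ^ 2 * ∫ ρ in δ..R, ρ * ‖f ρ‖ ^ 2 := by
        field_simp
        ring

/-- **(2.1) = FBC-1 on a ray**: if `ρ|w(ρ)| ≤ C₁/ln²ρ` on `(0, 2δ]`, `ρ|w(ρ)| ≤ M` for `ρ > 0`,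
`2δ < 1`, then for every `C¹` profile `f` and `R ≥ 2δ`,
`∫₀ᴿ |w| ‖f‖² ≤ 16C₁ ∫₀ᴿ ρ‖f'‖² + (16C₁D² + 2M)δ⁻² ∫_δ^R ρ‖f‖²`.
[cite: LeiZhang2017, proof of Cor. 1.3, (2.1) (arXiv p. 7)] -/
theorem ray_fbc_one (hδ : 0 < δ) (h2δ : 2 * δ < 1) (hw : Continuous w) (hf : ContDiff ℝ 1 f)
    (hC₁ : 0 ≤ C₁) (hM : 0 ≤ M) (hD : ∀ t, |deriv Real.smoothTransition t| ≤ D)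
    (hmod : ∀ ρ, 0 < ρ → ρ ≤ 2 * δ → ρ * |w ρ| ≤ C₁ / Real.log ρ ^ 2)
    (hbd : ∀ ρ, 0 < ρ → ρ * |w ρ| ≤ M) (hR : 2 * δ ≤ R) :
    ∫ ρ in (0 : ℝ)..R, |w ρ| * ‖f ρ‖ ^ 2 ≤
      16 * C₁ * (∫ ρ in (0 : ℝ)..R, ρ * ‖deriv f ρ‖ ^ 2) +
        (16 * C₁ * D ^ 2 + 2 * M) / δ ^ 2 * ∫ ρ in δ..R, ρ * ‖f ρ‖ ^ 2 := by
  set a := 2 * δ with ha_def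
  have ha0 : 0 < a := by positivity
  have hδR : δ ≤ R := by linarith
  have hR0 : 0 ≤ R := by linarith
  set φ := Wei2016.radialCutoff a with hφ_def
  have hφcont : Continuous φ := (contDiff_radialCutoff a (n := 0)).continuous
  have hfc : Continuous f := hf.continuous
  have hf'c : Continuous (deriv f) := hf.continuous_deriv_one
  have hφ1 : ∀ ρ, ρ ≤ δ → φ ρ = 1 := fun ρ hρ =>
    Wei2016.radialCutoff_eq_one ha0 (by rw [ha_def]; linarith)
  have hφ01 : ∀ ρ, 0 ≤ 1 - φ ρ ∧ 1 - φ ρ ≤ 1 := fun ρ =>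
    ⟨sub_nonneg.2 (Wei2016.radialCutoff_le_one a ρ), by linarith [Wei2016.radialCutoff_nonneg a ρ]⟩
  -- near and far parts
  have hnear := ray_near_le (f := f) hδ h2δ hw hf hC₁ hD hmod hR
  have hint_w : ∀ b c, IntervalIntegrable (fun ρ => |w ρ| * ‖f ρ‖ ^ 2) volume b c := fun b c =>
    ((continuous_abs.comp hw).mul (hfc.norm.pow 2)).intervalIntegrable b c
  have hint_n : ∀ b c, IntervalIntegrable (fun ρ => |w ρ| * ‖φ ρ • f ρ‖ ^ 2) volume b c := fun b c =>
    ((continuous_abs.comp hw).mul ((hφcont.smul hfc).norm.pow 2)).intervalIntegrable b c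
  have hint_far : ∀ b c, IntervalIntegrable (fun ρ => |w ρ| * ‖(1 - φ ρ) • f ρ‖ ^ 2) volume b c :=
    fun b c => ((continuous_abs.comp hw).mul
      (((continuous_const.sub hφcont).smul hfc).norm.pow 2)).intervalIntegrable b c
  have hint_f : ∀ b c, IntervalIntegrable (fun ρ => ρ * ‖f ρ‖ ^ 2) volume b c := fun b c =>
    (continuous_id.mul (hfc.norm.pow 2)).intervalIntegrable b c
  -- the far part: vanishes on `[0, δ]`, and `|w| ≤ M/ρ ≤ Mρ/δ²` on `[δ, R]`
  have hfar : ∫ ρ in (0 : ℝ)..R, |w ρ| * ‖(1 - φ ρ) • f ρ‖ ^ 2 ≤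
      M / δ ^ 2 * ∫ ρ in δ..R, ρ * ‖f ρ‖ ^ 2 := by
    rw [← integral_add_adjacent_intervals (hint_far 0 δ) (hint_far δ R)]
    have hz : ∫ ρ in (0 : ℝ)..δ, |w ρ| * ‖(1 - φ ρ) • f ρ‖ ^ 2 = 0 := by
      have heq : EqOn (fun ρ => |w ρ| * ‖(1 - φ ρ) • f ρ‖ ^ 2) (fun _ => (0 : ℝ)) (uIcc 0 δ) :=
        fun ρ hρ => by
          rw [uIcc_of_le hδ.le] at hρ
          simp [hφ1 ρ hρ.2]
      rw [intervalIntegral.integral_congr heq]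
      simp
    rw [hz, zero_add, ← intervalIntegral.integral_const_mul]
    refine integral_mono_on hδR (hint_far δ R) ((hint_f δ R).const_mul _) fun ρ hρ => ?_
    have hρ0 : 0 < ρ := hδ.trans_le hρ.1
    have h1 : ‖(1 - φ ρ) • f ρ‖ ^ 2 ≤ ‖f ρ‖ ^ 2 := by
      rw [norm_smul, mul_pow, Real.norm_eq_abs, abs_of_nonneg (hφ01 ρ).1]
      have : (1 - φ ρ) ^ 2 ≤ 1 := by nlinarith [(hφ01 ρ).1, (hφ01 ρ).2]
      nlinarith [sq_nonneg ‖f ρ‖]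
    have h2 : |w ρ| ≤ M / δ ^ 2 * ρ := by
      have hb := hbd ρ hρ0
      have : |w ρ| ≤ M / ρ := by rw [le_div_iff₀ hρ0, mul_comm]; exact hb
      refine this.trans ?_
      rw [div_le_iff₀ hρ0]
      have hδρ : δ ^ 2 ≤ ρ * ρ := by nlinarith [hρ.1, hδ.le]
      calc M = M / δ ^ 2 * δ ^ 2 := by field_simp
        _ ≤ M / δ ^ 2 * (ρ * ρ) := by gcongr
        _ = M / δ ^ 2 * ρ * ρ := by ring
    calc |w ρ| * ‖(1 - φ ρ) • f ρ‖ ^ 2 ≤ (M / δ ^ 2 * ρ) * ‖f ρ‖ ^ 2 := by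
          gcongr
      _ = M / δ ^ 2 * (ρ * ‖f ρ‖ ^ 2) := by ring
  -- the splitting `‖f‖² ≤ 2‖φf‖² + 2‖(1−φ)f‖²`
  have hsplit : ∫ ρ in (0 : ℝ)..R, |w ρ| * ‖f ρ‖ ^ 2 ≤
      2 * (∫ ρ in (0 : ℝ)..R, |w ρ| * ‖φ ρ • f ρ‖ ^ 2) +
        2 * ∫ ρ in (0 : ℝ)..R, |w ρ| * ‖(1 - φ ρ) • f ρ‖ ^ 2 := by
    rw [← intervalIntegral.integral_const_mul, ← intervalIntegral.integral_const_mul,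
      ← intervalIntegral.integral_add ((hint_n 0 R).const_mul 2) ((hint_far 0 R).const_mul 2)]
    refine integral_mono_on hR0 (hint_w 0 R) (((hint_n 0 R).const_mul 2).add
      ((hint_far 0 R).const_mul 2)) fun ρ _ => ?_
    have h1 := norm_add_sq_le_two_mul (φ ρ • f ρ) ((1 - φ ρ) • f ρ)
    have he : φ ρ • f ρ + (1 - φ ρ) • f ρ = f ρ := by rw [← add_smul]; simp
    rw [he] at h1
    nlinarith [abs_nonneg (w ρ)]
  have hI2 : 0 ≤ ∫ ρ in δ..R, ρ * ‖f ρ‖ ^ 2 :=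
    intervalIntegral.integral_nonneg hδR fun ρ hρ => mul_nonneg (hδ.le.trans hρ.1) (sq_nonneg _)
  calc ∫ ρ in (0 : ℝ)..R, |w ρ| * ‖f ρ‖ ^ 2
      ≤ 2 * (∫ ρ in (0 : ℝ)..R, |w ρ| * ‖φ ρ • f ρ‖ ^ 2) +
          2 * ∫ ρ in (0 : ℝ)..R, |w ρ| * ‖(1 - φ ρ) • f ρ‖ ^ 2 := hsplit
    _ ≤ 2 * (8 * C₁ * (∫ ρ in (0 : ℝ)..R, ρ * ‖deriv f ρ‖ ^ 2) +
          8 * C₁ * D ^ 2 / δ ^ 2 * ∫ ρ in δ..R, ρ * ‖f ρ‖ ^ 2) +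
          2 * (M / δ ^ 2 * ∫ ρ in δ..R, ρ * ‖f ρ‖ ^ 2) := by gcongr
    _ = 16 * C₁ * (∫ ρ in (0 : ℝ)..R, ρ * ‖deriv f ρ‖ ^ 2) +
          (16 * C₁ * D ^ 2 + 2 * M) / δ ^ 2 * ∫ ρ in δ..R, ρ * ‖f ρ‖ ^ 2 := by
        field_simp
        ring

/-- **(2.2) = FBC-2 on a ray**: under the hypotheses of `ray_fbc_one`,
`∫₀ᴿ ρ w² ‖f‖² ≤ (16C₁²/ln²(2δ)) ∫₀ᴿ ρ‖f'‖² + (16C₁²D²/ln²(2δ) + 2M²)δ⁻² ∫_δ^R ρ‖f‖²`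
(`ρ w² = |Γ| · |w|/… `: near the axis `ρ|w| ≤ C₁/ln²ρ ≤ C₁/ln²(2δ)` reduces to (2.1)'s near term,
far from it `ρ w² ≤ M²/ρ ≤ M²ρ/δ²`). [cite: LeiZhang2017, proof of Cor. 1.3, (2.2) (arXiv p. 7)] -/
theorem ray_fbc_two (hδ : 0 < δ) (h2δ : 2 * δ < 1) (hw : Continuous w) (hf : ContDiff ℝ 1 f)
    (hC₁ : 0 ≤ C₁) (hD : ∀ t, |deriv Real.smoothTransition t| ≤ D)
    (hmod : ∀ ρ, 0 < ρ → ρ ≤ 2 * δ → ρ * |w ρ| ≤ C₁ / Real.log ρ ^ 2)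
    (hbd : ∀ ρ, 0 < ρ → ρ * |w ρ| ≤ M) (hR : 2 * δ ≤ R) :
    ∫ ρ in (0 : ℝ)..R, ρ * w ρ ^ 2 * ‖f ρ‖ ^ 2 ≤
      16 * C₁ ^ 2 / Real.log (2 * δ) ^ 2 * (∫ ρ in (0 : ℝ)..R, ρ * ‖deriv f ρ‖ ^ 2) +
        (16 * C₁ ^ 2 * D ^ 2 / Real.log (2 * δ) ^ 2 + 2 * M ^ 2) / δ ^ 2 *
          ∫ ρ in δ..R, ρ * ‖f ρ‖ ^ 2 := by
  set a := 2 * δ with ha_def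
  have ha0 : 0 < a := by positivity
  have ha1 : a < 1 := h2δ
  have hδR : δ ≤ R := by linarith
  have hR0 : 0 ≤ R := by linarith
  have haR : a ≤ R := hR
  set L := Real.log a ^ 2 with hL_def
  have hLpos : 0 < L := sq_pos_of_neg (Real.log_neg ha0 ha1)
  set φ := Wei2016.radialCutoff a with hφ_def
  have hφcont : Continuous φ := (contDiff_radialCutoff a (n := 0)).continuous
  have hfc : Continuous f := hf.continuous
  have hφ1 : ∀ ρ, ρ ≤ δ → φ ρ = 1 := fun ρ hρ =>
    Wei2016.radialCutoff_eq_one ha0 (by rw [ha_def]; linarith)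
  have hφ0 : ∀ ρ, a ≤ ρ → φ ρ = 0 := fun ρ hρ => Wei2016.radialCutoff_eq_zero ha0 hρ
  have hφ01 : ∀ ρ, 0 ≤ 1 - φ ρ ∧ 1 - φ ρ ≤ 1 := fun ρ =>
    ⟨sub_nonneg.2 (Wei2016.radialCutoff_le_one a ρ), by linarith [Wei2016.radialCutoff_nonneg a ρ]⟩
  have hnear := ray_near_le (f := f) hδ h2δ hw hf hC₁ hD hmod hR
  -- interval integrability of the pieces
  have hwc2 : Continuous fun ρ => ρ * w ρ ^ 2 := continuous_id.mul (hw.pow 2)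
  have hint_L : ∀ b c, IntervalIntegrable (fun ρ => ρ * w ρ ^ 2 * ‖f ρ‖ ^ 2) volume b c := fun b c =>
    (hwc2.mul (hfc.norm.pow 2)).intervalIntegrable b c
  have hint_n2 : ∀ b c, IntervalIntegrable (fun ρ => ρ * w ρ ^ 2 * ‖φ ρ • f ρ‖ ^ 2) volume b c :=
    fun b c => (hwc2.mul ((hφcont.smul hfc).norm.pow 2)).intervalIntegrable b c
  have hint_far2 : ∀ b c, IntervalIntegrable (fun ρ => ρ * w ρ ^ 2 * ‖(1 - φ ρ) • f ρ‖ ^ 2)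
      volume b c := fun b c =>
    (hwc2.mul (((continuous_const.sub hφcont).smul hfc).norm.pow 2)).intervalIntegrable b c
  have hint_n : ∀ b c, IntervalIntegrable (fun ρ => |w ρ| * ‖φ ρ • f ρ‖ ^ 2) volume b c := fun b c =>
    ((continuous_abs.comp hw).mul ((hφcont.smul hfc).norm.pow 2)).intervalIntegrable b c
  have hint_f : ∀ b c, IntervalIntegrable (fun ρ => ρ * ‖f ρ‖ ^ 2) volume b c := fun b c =>
    (continuous_id.mul (hfc.norm.pow 2)).intervalIntegrable b c
  -- near: `ρ w² ‖φf‖² ≤ (C₁/L) |w| ‖φf‖²` on `(0, R)`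
  have hnear2 : ∫ ρ in (0 : ℝ)..R, ρ * w ρ ^ 2 * ‖φ ρ • f ρ‖ ^ 2 ≤
      C₁ / L * ∫ ρ in (0 : ℝ)..R, |w ρ| * ‖φ ρ • f ρ‖ ^ 2 := by
    rw [← intervalIntegral.integral_const_mul]
    refine integral_mono_on_of_le_Ioo hR0 (hint_n2 0 R) ((hint_n 0 R).const_mul _) fun ρ hρ => ?_
    rcases le_or_gt ρ a with hρa | hρa
    · have hm := hmod ρ hρ.1 hρa
      have hlog := log_sq_le_log_sq hρ.1 hρa ha1
      have hlogρ : 0 < Real.log ρ ^ 2 := hLpos.trans_le hlog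
      have h1 : ρ * |w ρ| ≤ C₁ / L :=
        hm.trans (div_le_div_of_nonneg_left hC₁ hLpos hlog)
      calc ρ * w ρ ^ 2 * ‖φ ρ • f ρ‖ ^ 2 = (ρ * |w ρ|) * (|w ρ| * ‖φ ρ • f ρ‖ ^ 2) := by
            rw [← sq_abs]; ring
        _ ≤ C₁ / L * (|w ρ| * ‖φ ρ • f ρ‖ ^ 2) := by gcongr
    · simp [hφ0 ρ hρa.le]
  -- far: vanishes on `[0, δ]`, `ρ w² ≤ M²/ρ ≤ M²ρ/δ²` on `[δ, R]`
  have hfar2 : ∫ ρ in (0 : ℝ)..R, ρ * w ρ ^ 2 * ‖(1 - φ ρ) • f ρ‖ ^ 2 ≤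
      M ^ 2 / δ ^ 2 * ∫ ρ in δ..R, ρ * ‖f ρ‖ ^ 2 := by
    rw [← integral_add_adjacent_intervals (hint_far2 0 δ) (hint_far2 δ R)]
    have hz : ∫ ρ in (0 : ℝ)..δ, ρ * w ρ ^ 2 * ‖(1 - φ ρ) • f ρ‖ ^ 2 = 0 := by
      have heq : EqOn (fun ρ => ρ * w ρ ^ 2 * ‖(1 - φ ρ) • f ρ‖ ^ 2) (fun _ => (0 : ℝ)) (uIcc 0 δ) :=
        fun ρ hρ => by
          rw [uIcc_of_le hδ.le] at hρ
          simp [hφ1 ρ hρ.2]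
      rw [intervalIntegral.integral_congr heq]
      simp
    rw [hz, zero_add, ← intervalIntegral.integral_const_mul]
    refine integral_mono_on hδR (hint_far2 δ R) ((hint_f δ R).const_mul _) fun ρ hρ => ?_
    have hρ0 : 0 < ρ := hδ.trans_le hρ.1
    have h1 : ‖(1 - φ ρ) • f ρ‖ ^ 2 ≤ ‖f ρ‖ ^ 2 := by
      rw [norm_smul, mul_pow, Real.norm_eq_abs, abs_of_nonneg (hφ01 ρ).1]
      have : (1 - φ ρ) ^ 2 ≤ 1 := by nlinarith [(hφ01 ρ).1, (hφ01 ρ).2]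
      nlinarith [sq_nonneg ‖f ρ‖]
    have h2 : ρ * w ρ ^ 2 ≤ M ^ 2 / δ ^ 2 * ρ := by
      have hb := hbd ρ hρ0
      have hb2 : (ρ * |w ρ|) ^ 2 ≤ M ^ 2 :=
        pow_le_pow_left₀ (mul_nonneg hρ0.le (abs_nonneg _)) hb 2
      rw [mul_pow, sq_abs] at hb2
      -- `ρ w² = (ρ|w|)²/ρ ≤ M²/ρ ≤ M² ρ/δ²`
      have hδρ : δ ^ 2 ≤ ρ ^ 2 := pow_le_pow_left₀ hδ.le hρ.1 2
      rw [div_mul_eq_mul_div, le_div_iff₀ (pow_pos hδ 2)]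
      nlinarith [mul_le_mul_of_nonneg_left hδρ (mul_nonneg hρ0.le (sq_nonneg (w ρ))),
        mul_nonneg hρ0.le (sq_nonneg (w ρ))]
    calc ρ * w ρ ^ 2 * ‖(1 - φ ρ) • f ρ‖ ^ 2 ≤ (M ^ 2 / δ ^ 2 * ρ) * ‖f ρ‖ ^ 2 := by gcongr
      _ = M ^ 2 / δ ^ 2 * (ρ * ‖f ρ‖ ^ 2) := by ring
  -- splitting
  have hsplit : ∫ ρ in (0 : ℝ)..R, ρ * w ρ ^ 2 * ‖f ρ‖ ^ 2 ≤
      2 * (∫ ρ in (0 : ℝ)..R, ρ * w ρ ^ 2 * ‖φ ρ • f ρ‖ ^ 2) +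
        2 * ∫ ρ in (0 : ℝ)..R, ρ * w ρ ^ 2 * ‖(1 - φ ρ) • f ρ‖ ^ 2 := by
    rw [← intervalIntegral.integral_const_mul, ← intervalIntegral.integral_const_mul,
      ← intervalIntegral.integral_add ((hint_n2 0 R).const_mul 2) ((hint_far2 0 R).const_mul 2)]
    refine integral_mono_on hR0 (hint_L 0 R) (((hint_n2 0 R).const_mul 2).add
      ((hint_far2 0 R).const_mul 2)) fun ρ hρ => ?_
    have h1 := norm_add_sq_le_two_mul (φ ρ • f ρ) ((1 - φ ρ) • f ρ)
    have he : φ ρ • f ρ + (1 - φ ρ) • f ρ = f ρ := by rw [← add_smul]; simp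
    rw [he] at h1
    have hρw : 0 ≤ ρ * w ρ ^ 2 := mul_nonneg hρ.1 (sq_nonneg _)
    nlinarith
  have hI1 : 0 ≤ ∫ ρ in (0 : ℝ)..R, ρ * ‖deriv f ρ‖ ^ 2 :=
    intervalIntegral.integral_nonneg hR0 fun ρ hρ => mul_nonneg hρ.1 (sq_nonneg _)
  have hI2 : 0 ≤ ∫ ρ in δ..R, ρ * ‖f ρ‖ ^ 2 :=
    intervalIntegral.integral_nonneg hδR fun ρ hρ => mul_nonneg (hδ.le.trans hρ.1) (sq_nonneg _)
  have hCL : 0 ≤ C₁ / L := div_nonneg hC₁ hLpos.le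
  calc ∫ ρ in (0 : ℝ)..R, ρ * w ρ ^ 2 * ‖f ρ‖ ^ 2
      ≤ 2 * (∫ ρ in (0 : ℝ)..R, ρ * w ρ ^ 2 * ‖φ ρ • f ρ‖ ^ 2) +
          2 * ∫ ρ in (0 : ℝ)..R, ρ * w ρ ^ 2 * ‖(1 - φ ρ) • f ρ‖ ^ 2 := hsplit
    _ ≤ 2 * (C₁ / L * (8 * C₁ * (∫ ρ in (0 : ℝ)..R, ρ * ‖deriv f ρ‖ ^ 2) +
          8 * C₁ * D ^ 2 / δ ^ 2 * ∫ ρ in δ..R, ρ * ‖f ρ‖ ^ 2)) +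
          2 * (M ^ 2 / δ ^ 2 * ∫ ρ in δ..R, ρ * ‖f ρ‖ ^ 2) := by
        gcongr
        exact hnear2.trans (mul_le_mul_of_nonneg_left hnear hCL)
    _ = 16 * C₁ ^ 2 / Real.log (2 * δ) ^ 2 * (∫ ρ in (0 : ℝ)..R, ρ * ‖deriv f ρ‖ ^ 2) +
        (16 * C₁ ^ 2 * D ^ 2 / Real.log (2 * δ) ^ 2 + 2 * M ^ 2) / δ ^ 2 *
          ∫ ρ in δ..R, ρ * ‖f ρ‖ ^ 2 := by
        simp only [hL_def, ha_def]
        field_simp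
        ring

end Ray

/-! ### On `ℝ³` -/

section Space

variable {u : EuclideanSpace ℝ (Fin 3) → EuclideanSpace ℝ (Fin 3)}
  {F : EuclideanSpace ℝ (Fin 3) → E} {C₁ M δ : ℝ}

/-- The profile identities along the ray at height `z`: for an axisymmetric `u ∈ C²`,
`ρ · |angVelQuot u (ρ,0,z)| = |u₁(ρ,0,z)|` for `ρ ≥ 0`. [folklore] -/
theorem mul_abs_angVelQuot_meridianPoint (hax : IsAxisymmetric u) (hu : ContDiff ℝ 2 u) {ρ : ℝ}
    (hρ : 0 ≤ ρ) (z : ℝ) :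
    ρ * |angVelQuot u (meridianPoint (ρ, z))| = |u (meridianPoint (ρ, z)) 1| := by
  rcases eq_or_lt_of_le hρ with h0 | hpos
  · rw [← h0, zero_mul]
    have hax' := Wei2016.apply_zero_one_eq_zero_of_axis hax (x := meridianPoint (0, z)) rfl rfl
    rw [hax'.2, abs_zero]
  · have h := hax.cylRadius_sq_mul_angVelQuot hu (meridianPoint (ρ, z))
    rw [cylRadius_meridianPoint_eq_abs, abs_of_pos hpos, Wei2016.swirl_meridianPoint] at h
    -- `ρ² Φ = ρ u₁`, so `ρ Φ = u₁`
    have h' : ρ * angVelQuot u (meridianPoint (ρ, z)) = u (meridianPoint (ρ, z)) 1 := by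
      apply mul_left_cancel₀ hpos.ne'
      linear_combination h
    rw [← h', abs_mul, abs_of_pos hpos]

/-- The modulus hypotheses along a ray: `ρ |u₁(ρ,0,z)| = |Γ(ρ,0,z)|`. [folklore] -/
theorem mul_abs_apply_one_eq_abs_swirl (u : EuclideanSpace ℝ (Fin 3) → EuclideanSpace ℝ (Fin 3))
    {ρ : ℝ} (hρ : 0 < ρ) (z : ℝ) :
    ρ * |u (meridianPoint (ρ, z)) 1| = |swirl u (meridianPoint (ρ, z))| := by
  rw [Wei2016.swirl_meridianPoint, abs_mul, abs_of_pos hρ]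

/-- **(FBC-1) on `ℝ³` from the critical modulus** (Lei–Zhang 2017, (2.1) integrated,
`dx = r dr dθ dz`). Let `u ∈ C²` be axisymmetric with `|Γ(x)| ≤ C₁/ln²r(x)` for
`0 < r(x) ≤ 2δ` (`2δ < 1`) and `|Γ| ≤ M`; let `F ∈ C¹` take values in a real inner product space,
with `‖F‖²` and `‖DF[e_r]‖²` axisymmetric and `|u^θ/r| ‖F‖²`, `‖DF[e_r]‖²`, `‖F‖²` integrable. Then
`∫ |u^θ/r| ‖F‖² ≤ 16C₁ ∫ ‖DF[e_r]‖² + (16C₁D² + 2M)δ⁻² ∫_{r > δ} ‖F‖²` (`u^θ/r = angVelQuot u`,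
`D = Wei2016.stDerivBound`). [cite: LeiZhang2017, proof of Cor. 1.3, (2.1) (arXiv p. 7)] -/
theorem integral_abs_angVelQuot_mul_norm_sq_le (hax : IsAxisymmetric u) (hu : ContDiff ℝ 2 u)
    (hF : ContDiff ℝ 1 F) (hFn : IsAxisymmetricScalar fun x => ‖F x‖ ^ 2)
    (hDFn : IsAxisymmetricScalar fun x => ‖fderiv ℝ F x (eR x)‖ ^ 2)
    (hδ : 0 < δ) (h2δ : 2 * δ < 1) (hC₁ : 0 ≤ C₁) (hM : 0 ≤ M)
    (hmod : ∀ x, 0 < cylRadius x → cylRadius x ≤ 2 * δ →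
      |swirl u x| ≤ C₁ / Real.log (cylRadius x) ^ 2)
    (hbd : ∀ x, |swirl u x| ≤ M)
    (hAi : Integrable fun x => |angVelQuot u x| * ‖F x‖ ^ 2)
    (hBi : Integrable fun x => ‖fderiv ℝ F x (eR x)‖ ^ 2)
    (hCi : Integrable fun x => ‖F x‖ ^ 2) :
    ∫ x, |angVelQuot u x| * ‖F x‖ ^ 2 ≤
      16 * C₁ * (∫ x, ‖fderiv ℝ F x (eR x)‖ ^ 2) +
        (16 * C₁ * Wei2016.stDerivBound ^ 2 + 2 * M) / δ ^ 2 *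
          ∫ x in {x | δ < cylRadius x}, ‖F x‖ ^ 2 := by
  have hΦax : IsAxisymmetricScalar fun x => |angVelQuot u x| := fun θ x => by
    simp only [hax.isAxisymmetricScalar_angVelQuot hu θ x]
  have hAa : IsAxisymmetricScalar fun x => |angVelQuot u x| * ‖F x‖ ^ 2 := fun θ x => by
    simp only [hΦax θ x, hFn θ x]
  have hFd : Differentiable ℝ F := hF.differentiable one_ne_zero
  obtain ⟨hD0, hD⟩ := Wei2016.stDerivBound_spec
  refine Wei2016.integral_le_of_forall_ray_le (R₀ := 2 * δ) (c₀ := δ) hAa hDFn hFn hAi hBi hCi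
    hδ.le fun z R hR => ?_
  -- the profiles along the ray at height `z`
  set w : ℝ → ℝ := fun ρ => u (meridianPoint (ρ, z)) 1 with hw
  set f : ℝ → E := fun ρ => F (meridianPoint (ρ, z)) with hf
  have hmpc : ContDiff ℝ 1 fun ρ : ℝ => meridianPoint (ρ, z) :=
    contDiff_meridianPoint.comp (contDiff_id.prodMk contDiff_const)
  have hwc : Continuous w :=
    (EuclideanSpace.proj (1 : Fin 3)).continuous.comp (hu.continuous.comp hmpc.continuous)
  have hfC : ContDiff ℝ 1 f := hF.comp hmpc
  have hfd : ∀ ρ, HasDerivAt f (fderiv ℝ F (meridianPoint (ρ, z)) (EuclideanSpace.single 0 1)) ρ :=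
    fun ρ => (hFd _).hasFDerivAt.comp_hasDerivAt ρ (hasDerivAt_meridianPoint_fst ρ z)
  have hderiv : ∀ ρ, deriv f ρ = fderiv ℝ F (meridianPoint (ρ, z)) (EuclideanSpace.single 0 1) :=
    fun ρ => (hfd ρ).deriv
  -- hypotheses of the ray lemma
  have hmod' : ∀ ρ, 0 < ρ → ρ ≤ 2 * δ → ρ * |w ρ| ≤ C₁ / Real.log ρ ^ 2 := by
    intro ρ hρ hρδ
    have hx : cylRadius (meridianPoint (ρ, z)) = ρ := by
      rw [cylRadius_meridianPoint_eq_abs, abs_of_pos hρ]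
    have h := hmod (meridianPoint (ρ, z)) (by rw [hx]; exact hρ) (by rw [hx]; exact hρδ)
    rw [hx] at h
    rwa [hw, mul_abs_apply_one_eq_abs_swirl u hρ z]
  have hbd' : ∀ ρ, 0 < ρ → ρ * |w ρ| ≤ M := fun ρ hρ => by
    rw [hw, mul_abs_apply_one_eq_abs_swirl u hρ z]; exact hbd _
  have hray := ray_fbc_one (f := f) hδ h2δ hwc hfC hC₁ hM hD hmod' hbd' hR
  -- identify the three ray integrals
  have hRpos : 0 < R := (by positivity : (0 : ℝ) < 2 * δ).trans_le hR
  have eA : ∫ ρ in (0 : ℝ)..R, ρ * (|angVelQuot u (meridianPoint (ρ, z))| *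
      ‖F (meridianPoint (ρ, z))‖ ^ 2) = ∫ ρ in (0 : ℝ)..R, |w ρ| * ‖f ρ‖ ^ 2 := by
    refine intervalIntegral.integral_congr fun ρ hρ => ?_
    rw [uIcc_of_le hRpos.le] at hρ
    simp only [hw, hf]
    rw [← mul_assoc, mul_abs_angVelQuot_meridianPoint hax hu hρ.1 z]
  have eB : ∫ ρ in (0 : ℝ)..R, ρ * ‖fderiv ℝ F (meridianPoint (ρ, z)) (eR (meridianPoint (ρ, z)))‖ ^ 2 =
      ∫ ρ in (0 : ℝ)..R, ρ * ‖deriv f ρ‖ ^ 2 := by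
    refine intervalIntegral.integral_congr fun ρ hρ => ?_
    rw [uIcc_of_le hRpos.le] at hρ
    rcases eq_or_lt_of_le hρ.1 with h0 | hpos
    · simp [← h0]
    · simp only [hderiv ρ, eR_meridianPoint hpos z]
  have eC : ∫ ρ in δ..R, ρ * ‖F (meridianPoint (ρ, z))‖ ^ 2 = ∫ ρ in δ..R, ρ * ‖f ρ‖ ^ 2 := rfl
  rw [eA, eB, eC]
  exact hray

/-- **(FBC-2) on `ℝ³` from the critical modulus** (Lei–Zhang 2017, (2.2) integrated). Under the
hypotheses of `integral_abs_angVelQuot_mul_norm_sq_le` (with `(u^θ)² ‖F‖²` integrable instead),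
`∫ (u^θ)² ‖F‖² ≤ (16C₁²/ln²(2δ)) ∫ ‖DF[e_r]‖² + (16C₁²D²/ln²(2δ) + 2M²)δ⁻² ∫_{r > δ} ‖F‖²`,
where `(u^θ)² = (r · angVelQuot u)²`. [cite: LeiZhang2017, proof of Cor. 1.3, (2.2) (arXiv p. 7)] -/
theorem integral_swirl_sq_mul_norm_sq_le (hax : IsAxisymmetric u) (hu : ContDiff ℝ 2 u)
    (hF : ContDiff ℝ 1 F) (hFn : IsAxisymmetricScalar fun x => ‖F x‖ ^ 2)
    (hDFn : IsAxisymmetricScalar fun x => ‖fderiv ℝ F x (eR x)‖ ^ 2)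
    (hδ : 0 < δ) (h2δ : 2 * δ < 1) (hC₁ : 0 ≤ C₁)
    (hmod : ∀ x, 0 < cylRadius x → cylRadius x ≤ 2 * δ →
      |swirl u x| ≤ C₁ / Real.log (cylRadius x) ^ 2)
    (hbd : ∀ x, |swirl u x| ≤ M)
    (hAi : Integrable fun x => (cylRadius x * angVelQuot u x) ^ 2 * ‖F x‖ ^ 2)
    (hBi : Integrable fun x => ‖fderiv ℝ F x (eR x)‖ ^ 2)
    (hCi : Integrable fun x => ‖F x‖ ^ 2) :
    ∫ x, (cylRadius x * angVelQuot u x) ^ 2 * ‖F x‖ ^ 2 ≤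
      16 * C₁ ^ 2 / Real.log (2 * δ) ^ 2 * (∫ x, ‖fderiv ℝ F x (eR x)‖ ^ 2) +
        (16 * C₁ ^ 2 * Wei2016.stDerivBound ^ 2 / Real.log (2 * δ) ^ 2 + 2 * M ^ 2) / δ ^ 2 *
          ∫ x in {x | δ < cylRadius x}, ‖F x‖ ^ 2 := by
  have hΦax : IsAxisymmetricScalar fun x => (cylRadius x * angVelQuot u x) ^ 2 := fun θ x => by
    simp only [hax.isAxisymmetricScalar_angVelQuot hu θ x, cylRadius_rotZ]
  have hAa : IsAxisymmetricScalar fun x => (cylRadius x * angVelQuot u x) ^ 2 * ‖F x‖ ^ 2 :=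
    fun θ x => by simp only [hΦax θ x, hFn θ x]
  have hFd : Differentiable ℝ F := hF.differentiable one_ne_zero
  obtain ⟨hD0, hD⟩ := Wei2016.stDerivBound_spec
  refine Wei2016.integral_le_of_forall_ray_le (R₀ := 2 * δ) (c₀ := δ) hAa hDFn hFn hAi hBi hCi
    hδ.le fun z R hR => ?_
  set w : ℝ → ℝ := fun ρ => u (meridianPoint (ρ, z)) 1 with hw
  set f : ℝ → E := fun ρ => F (meridianPoint (ρ, z)) with hf
  have hmpc : ContDiff ℝ 1 fun ρ : ℝ => meridianPoint (ρ, z) :=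
    contDiff_meridianPoint.comp (contDiff_id.prodMk contDiff_const)
  have hwc : Continuous w :=
    (EuclideanSpace.proj (1 : Fin 3)).continuous.comp (hu.continuous.comp hmpc.continuous)
  have hfC : ContDiff ℝ 1 f := hF.comp hmpc
  have hfd : ∀ ρ, HasDerivAt f (fderiv ℝ F (meridianPoint (ρ, z)) (EuclideanSpace.single 0 1)) ρ :=
    fun ρ => (hFd _).hasFDerivAt.comp_hasDerivAt ρ (hasDerivAt_meridianPoint_fst ρ z)
  have hderiv : ∀ ρ, deriv f ρ = fderiv ℝ F (meridianPoint (ρ, z)) (EuclideanSpace.single 0 1) :=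
    fun ρ => (hfd ρ).deriv
  have hmod' : ∀ ρ, 0 < ρ → ρ ≤ 2 * δ → ρ * |w ρ| ≤ C₁ / Real.log ρ ^ 2 := by
    intro ρ hρ hρδ
    have hx : cylRadius (meridianPoint (ρ, z)) = ρ := by
      rw [cylRadius_meridianPoint_eq_abs, abs_of_pos hρ]
    have h := hmod (meridianPoint (ρ, z)) (by rw [hx]; exact hρ) (by rw [hx]; exact hρδ)
    rw [hx] at h
    rwa [hw, mul_abs_apply_one_eq_abs_swirl u hρ z]
  have hbd' : ∀ ρ, 0 < ρ → ρ * |w ρ| ≤ M := fun ρ hρ => by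
    rw [hw, mul_abs_apply_one_eq_abs_swirl u hρ z]; exact hbd _
  have hray := ray_fbc_two (f := f) hδ h2δ hwc hfC hC₁ hD hmod' hbd' hR
  have hRpos : 0 < R := (by positivity : (0 : ℝ) < 2 * δ).trans_le hR
  have eA : ∫ ρ in (0 : ℝ)..R, ρ * ((cylRadius (meridianPoint (ρ, z)) *
      angVelQuot u (meridianPoint (ρ, z))) ^ 2 * ‖F (meridianPoint (ρ, z))‖ ^ 2) =
      ∫ ρ in (0 : ℝ)..R, ρ * w ρ ^ 2 * ‖f ρ‖ ^ 2 := by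
    refine intervalIntegral.integral_congr fun ρ hρ => ?_
    rw [uIcc_of_le hRpos.le] at hρ
    simp only [hw, hf]
    have h1 := mul_abs_angVelQuot_meridianPoint hax hu hρ.1 z
    rw [cylRadius_meridianPoint_eq_abs, abs_of_nonneg hρ.1]
    have h2 : (ρ * angVelQuot u (meridianPoint (ρ, z))) ^ 2 = (u (meridianPoint (ρ, z)) 1) ^ 2 := by
      rw [← sq_abs, abs_mul, abs_of_nonneg hρ.1, h1, sq_abs]
    rw [h2]
    ring
  have eB : ∫ ρ in (0 : ℝ)..R, ρ * ‖fderiv ℝ F (meridianPoint (ρ, z)) (eR (meridianPoint (ρ, z)))‖ ^ 2 =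
      ∫ ρ in (0 : ℝ)..R, ρ * ‖deriv f ρ‖ ^ 2 := by
    refine intervalIntegral.integral_congr fun ρ hρ => ?_
    rw [uIcc_of_le hRpos.le] at hρ
    rcases eq_or_lt_of_le hρ.1 with h0 | hpos
    · simp [← h0]
    · simp only [hderiv ρ, eR_meridianPoint hpos z]
  have eC : ∫ ρ in δ..R, ρ * ‖F (meridianPoint (ρ, z))‖ ^ 2 = ∫ ρ in δ..R, ρ * ‖f ρ‖ ^ 2 := rfl
  rw [eA, eB, eC]
  exact hray

end Space



end LeiZhang2017

end Literature.Analysis.FluidPDE
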